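import Literature.NumberTheory.EllipticCurves.Sprung2012.SharpFlatSelmer
import HarnessLib

/-!
# Route `ByReductionTypeAtTwo` (rung K4), crux `SupersingularRankZeroAtTwo` (item stmt-BirchSwinnertonDyer-19097), line
# `odd_blind_package` v2.18, stub `stub_flatPackage`, conjunct (8), clause F1♭ — **THE EXACTNESS ASSEMBLY**: `Function.Exact loc toX ∧
# Function.Exact toX δ` on `P := ⊤` from the FOUR INCLUSIONS, and the dictionary to the hands' currencies (cell `bsd-2adic`, seat
# `bsd-2adic-tower-1` GEN 68, hand hF1♭-ORTH FILE 3; `--supports 19097`, helper)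

HONEST FRAMING (D-0054): THEOREMS ONLY — no definition, no named fact, no instance, no `sorry`.  CONSUMER file: it proves nothing
arithmetic; it packages.  Helper toward conjunct (8); closes NO stub; 19097 stays OPEN on its 5 registered stubs; nothing booked; BSD₂ is
proved for no supersingular curve and BSD for no curve by any of this; typed ≠ proved.

## What and why

Conjunct (8) of `FlatCKPackageAtTwo` (v2.18, (R1) keying) displays `∃ (P : Submodule Λ Λ) (loc : I.H →ₗ[Λ] P) (toX : P →ₗ[Λ] D.X)
(δ : D.X →ₗ[Λ] Y.X) …, Function.Exact loc toX ∧ Function.Exact toX δ ∧ …`.  The displayed-witness contract (tower-1 GEN 67 §6, pen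
RC-800) fixes `P := ⊤`, `loc := Col♭ ∘ₗ L` corestricted, `toX := toX₀|_⊤` (p831519), `δ :=` the transpose of `Sel₀ ≤ Sel♭`
(`Sprung2012.SharpFlatSelmerDualData.exists_linearMap_toFineDual'`).  The two exactness clauses are then EXACTLY four inclusions on the
un-restricted maps `loc₀ : H →ₗ Λ`, `toX₀ : Λ →ₗ X`, `δ : X →ₗ Y`:
(⊆₁) `toX₀ ∘ loc₀ = 0` = T-ORTH (`SSFlatPT.toX_snd_apply_eq_zero`, tower-1 GEN 68 FILE 1c); (⊇₁) `ker toX₀ ⊆ range loc₀` = T-LIM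
(`SSFlatPT.exists_snd_coleman_apply_eq_of_levelwise`, t42 GEN 49, from (LEV)+(FIN), hand hF1♭-LEV); (⊆₂) `δ ∘ toX₀ = 0` = (δ̄) of p831519;
(⊇₂) `ker δ ⊆ range toX₀` = T-δ (`SSFlatPT.exists_toX_apply_eq_of_transpose_eq_zero`, tower-1 GEN 68 FILE 2).  §1 is the pure linear
algebra both ways (`exists_exact_and_exact_of_inclusions`, `inclusions_of_exact_and_exact`); §2 is the dictionary: (⊇₁) in the shape the
hands deliver it — «every `w` with ORTH is `≡ L x (mod Ker Col♭)`» + `Col♭` onto + the values (V̄) of `toX` (`orth_of_toX_apply_eq_zero`: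
`toX (Col♭ w) = 0 ⇒ ORTH w`, t42's predicate VERBATIM).

## What is proved
* §1 `exact_codRestrict_top_and_exact_comp_subtype`, ★ `exists_exact_and_exact_of_inclusions`, `inclusions_of_exact_and_exact` (any
  commutative ring, any modules).
* §2 `orth_of_toX_apply_eq_zero`, ★ `exists_snd_apply_eq_of_toX_eq_zero` (any number field, prime, `ℤ_p`-extension, place, ♭ datum of
  any key).

References: [Sprung2012] Def. 7.9, Def. 7.11 (p. 1503), Prop. 7.19 (p. 1505); [Kobayashi2003] (7.17)–(7.21) (p. 12); [GreenbergLNM1716] §4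
pp. 121–122; [Kato2004Asterisque] §17.13 (p. 279).
-/

set_option autoImplicit false
-- the Theorems namespace of this sub repeats the summit name by design (D-0017 nested layout)
set_option linter.dupNamespace false

noncomputable section

open scoped Classical NumberField

namespace Summit.BirchSwinnertonDyer.BirchSwinnertonDyer.Theorems

namespace SSFlatPT

open NumberField IsDedekindDomain Field WeierstrassCurve
  Literature.NumberTheory.EllipticCurves Literature.NumberTheory.EllipticCurves.Kobayashi2003
  Literature.NumberTheory.EllipticCurves.Sprung2012 Literature.NumberTheory.EllipticCurves.Sprung2017
  Literature.NumberTheory.GaloisRepresentations ZpExtension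

/-! ## §1 Pure linear algebra: two exactness clauses on `P := ⊤` from four inclusions -/

section Algebra

variable {R : Type*} [CommRing R] {H A X Y : Type*} [AddCommGroup H] [Module R H] [AddCommGroup A] [Module R A]
  [AddCommGroup X] [Module R X] [AddCommGroup Y] [Module R Y]
  (loc₀ : H →ₗ[R] A) (toX₀ : A →ₗ[R] X) (δ : X →ₗ[R] Y)

/-- **`Exact loc toX ∧ Exact toX δ` on `P := ⊤` from the four inclusions** `toX₀ ∘ loc₀ = 0`, `ker toX₀ ⊆ range loc₀`, `δ ∘ toX₀ = 0`,
`ker δ ⊆ range toX₀`, with `loc := loc₀` corestricted to `⊤` and `toX := toX₀|_⊤`. [folklore] -/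
theorem exact_codRestrict_top_and_exact_comp_subtype (h₁ : ∀ x, toX₀ (loc₀ x) = 0) (h₂ : ∀ f, toX₀ f = 0 → ∃ x, loc₀ x = f)
    (h₃ : ∀ f, δ (toX₀ f) = 0) (h₄ : ∀ y, δ y = 0 → ∃ f, toX₀ f = y) :
    Function.Exact (LinearMap.codRestrict (⊤ : Submodule R A) loc₀ (fun _ ↦ Submodule.mem_top))
        (toX₀ ∘ₗ (⊤ : Submodule R A).subtype) ∧
      Function.Exact (toX₀ ∘ₗ (⊤ : Submodule R A).subtype) δ := by
  constructor
  · intro f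
    constructor
    · intro hf
      obtain ⟨x, hx⟩ := h₂ (f : A) hf
      exact ⟨x, Subtype.ext hx⟩
    · rintro ⟨x, rfl⟩
      exact h₁ x
  · intro y
    constructor
    · intro hy
      obtain ⟨f, hf⟩ := h₄ y hy
      exact ⟨⟨f, Submodule.mem_top⟩, hf⟩
    · rintro ⟨f, rfl⟩
      exact h₃ (f : A)

/-- **The displayed-witness form of conjunct (8)'s F1♭ block**: from the four inclusions there are `P` (`= ⊤`), a linear
`loc : H →ₗ P` lifting `loc₀` and a linear `toX : P →ₗ X` restricting `toX₀` with `Function.Exact loc toX ∧ Function.Exact toX δ`.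
[folklore] -/
theorem exists_exact_and_exact_of_inclusions (h₁ : ∀ x, toX₀ (loc₀ x) = 0) (h₂ : ∀ f, toX₀ f = 0 → ∃ x, loc₀ x = f)
    (h₃ : ∀ f, δ (toX₀ f) = 0) (h₄ : ∀ y, δ y = 0 → ∃ f, toX₀ f = y) :
    ∃ (P : Submodule R A) (loc : H →ₗ[R] P) (toX : P →ₗ[R] X),
      Function.Exact loc toX ∧ Function.Exact toX δ ∧ P = ⊤ ∧ (∀ x, (loc x : A) = loc₀ x) ∧ ∀ f, toX f = toX₀ (f : A) := by
  obtain ⟨hA, hB⟩ := exact_codRestrict_top_and_exact_comp_subtype loc₀ toX₀ δ h₁ h₂ h₃ h₄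
  exact ⟨⊤, LinearMap.codRestrict (⊤ : Submodule R A) loc₀ (fun _ ↦ Submodule.mem_top), toX₀ ∘ₗ (⊤ : Submodule R A).subtype,
    hA, hB, rfl, fun _ ↦ rfl, fun _ ↦ rfl⟩

/-- Conversely, the packaged exactness clauses give back the four inclusions for `loc₀`, `toX₀`: nothing is lost by the
`P := ⊤` normalisation. [folklore] -/
theorem inclusions_of_exact_and_exact {P : Submodule R A} {loc : H →ₗ[R] P} {toX : P →ₗ[R] X}
    (hA : Function.Exact loc toX) (hB : Function.Exact toX δ) (hP : P = ⊤) (hloc : ∀ x, (loc x : A) = loc₀ x)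
    (htoX : ∀ f, toX f = toX₀ (f : A)) :
    (∀ x, toX₀ (loc₀ x) = 0) ∧ (∀ f, toX₀ f = 0 → ∃ x, loc₀ x = f) ∧ (∀ f, δ (toX₀ f) = 0) ∧
      ∀ y, δ y = 0 → ∃ f, toX₀ f = y := by
  subst hP
  refine ⟨fun x ↦ ?_, fun f hf ↦ ?_, fun f ↦ ?_, fun y hy ↦ ?_⟩
  · rw [← hloc x, ← htoX]
    exact (hA (loc x)).mpr ⟨x, rfl⟩
  · have h : toX ⟨f, Submodule.mem_top⟩ = 0 := by rw [htoX]; exact hf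
    obtain ⟨x, hx⟩ := (hA _).mp h
    exact ⟨x, by rw [← hloc, hx]⟩
  · have h := (hB (toX ⟨f, Submodule.mem_top⟩)).mpr ⟨_, rfl⟩
    rwa [htoX] at h
  · obtain ⟨f, hf⟩ := (hB y).mp hy
    exact ⟨f, by rw [← htoX, hf]⟩

end Algebra

/-! ## §2 The dictionary to the tree's currency: (⊇₁) from T-LIM (ORTH form) and the values (V̄) of `toX` -/

section Dictionary

variable {K : Type} [Field K] [NumberField K] (W : WeierstrassCurve K) {p : ℕ} [hp : Fact p.Prime]
  (κ : ZpExtension K p) (v : HeightOneSpectrum (𝓞 K)) {ap : ℤ}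
  {g : absoluteGaloisGroup (v.adicCompletion K)} {c : ℕ → localPoints W (v.adicCompletion K)}

/-- **`toX (Col♭ w) = 0 ⇒ ORTH w`.**  If `toX` has the Kummer values (V̄) of `SSFlatPackage.exists_flatToXLinearMap_of_mul_eq_one`
(`D.toDual (toX (J w).2) s = w(p^k Q)/p^k` for every Kummer datum of `s ∈ Sel♭`) then `toX (J w).2 = 0` forces every Kummer value of
`w` on ♭-Selmer data to vanish — t42's predicate ORTH, VERBATIM (the hypothesis `hlev`-producer of hand hF1♭-LEV).
[cite: Kobayashi2003, (7.17)–(7.21) (p. 12)] [cite: Sprung2012, Def. 7.9, Def. 7.11 (p. 1503)] -/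
theorem orth_of_toX_apply_eq_zero {Λ' : Type*}
    (J : (localTowerPointsOfEmb κ (closureEmb (K := K) (v.adicCompletion K)) W →+ ℤ_[p]) → Λ')
    {δk : absoluteGaloisGroup K}
    (D : SharpFlatSelmerDualData W κ δk (closureEmb (K := K) (v.adicCompletion K)) ap g c .flat) (toX : Λ' → D.X)
    (hV : ∀ (w : localTowerPointsOfEmb κ (closureEmb (K := K) (v.adicCompletion K)) W →+ ℤ_[p])
        (s : sharpFlatSelmerInfty W κ (closureEmb (K := K) (v.adicCompletion K)) ap g c .flat)
        (φ : contOneCocycles (discreteTopRep κ.kerSubgroup (W.geomPrimaryTorsion p)))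
        (Q : localPoints W (v.adicCompletion K)) (k : ℕ)
        (hQ : (p ^ k) • Q ∈ localTowerPointsOfEmb κ (closureEmb (K := K) (v.adicCompletion K)) W),
        oneCocycleClass (discreteTopRep κ.kerSubgroup (W.geomPrimaryTorsion p)) φ = (s : W.subgroupH1 p κ.kerSubgroup) →
        (∀ τ : localSubgroupOfEmb κ.kerSubgroup (closureEmb (K := K) (v.adicCompletion K)),
          pointsMapOfEmb W (closureEmb (K := K) (v.adicCompletion K))
              ((φ.1 (resGalSubgroupOfEmb κ.kerSubgroup _ τ) : W.geomPrimaryTorsion p) : W.geomPoints) =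
            (τ : absoluteGaloisGroup (v.adicCompletion K)) • Q - Q) →
        ∀ a : ℤ, PadicInt.toZModPow k (w ⟨(p ^ k) • Q, hQ⟩) = (a : ZMod (p ^ k)) →
          D.toDual (toX (J w)) s = (((a : ℚ) / (p : ℚ) ^ k : ℚ) : AddCircle (1 : ℚ)))
    (w : localTowerPointsOfEmb κ (closureEmb (K := K) (v.adicCompletion K)) W →+ ℤ_[p]) (hw : toX (J w) = 0) :
    ∀ (s : sharpFlatSelmerInfty W κ (closureEmb (K := K) (v.adicCompletion K)) ap g c .flat)
      (φ : contOneCocycles (discreteTopRep κ.kerSubgroup (W.geomPrimaryTorsion p)))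
      (Q : localPoints W (v.adicCompletion K)) (k : ℕ)
      (hQ : (p ^ k) • Q ∈ localTowerPointsOfEmb κ (closureEmb (K := K) (v.adicCompletion K)) W),
      oneCocycleClass (discreteTopRep κ.kerSubgroup (W.geomPrimaryTorsion p)) φ = (s : W.subgroupH1 p κ.kerSubgroup) →
      (∀ τ : localSubgroupOfEmb κ.kerSubgroup (closureEmb (K := K) (v.adicCompletion K)),
        pointsMapOfEmb W (closureEmb (K := K) (v.adicCompletion K))
            ((φ.1 (resGalSubgroupOfEmb κ.kerSubgroup _ τ) : W.geomPrimaryTorsion p) : W.geomPoints) =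
          (τ : absoluteGaloisGroup (v.adicCompletion K)) • Q - Q) →
      PadicInt.toZModPow k (w ⟨(p ^ k) • Q, hQ⟩) = 0 := by
  intro s φ Q k hQ hφ hτ
  obtain ⟨a, ha⟩ := ZMod.intCast_surjective (PadicInt.toZModPow k (w ⟨(p ^ k) • Q, hQ⟩))
  have h := hV w s φ Q k hQ hφ hτ a ha.symm
  rw [hw, map_zero, AddMonoidHom.zero_apply] at h
  -- `a / p^k = 0` in `ℚ/ℤ` ⇒ `p^k ∣ a` ⇒ the residue vanishes
  have hp0 : ((p : ℚ) ^ k) ≠ 0 := pow_ne_zero k (Nat.cast_ne_zero.mpr hp.out.ne_zero)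
  obtain ⟨n, hn⟩ := (AddCircle.coe_eq_zero_iff (1 : ℚ)).mp h.symm
  rw [← ha, ZMod.intCast_zmod_eq_zero_iff_dvd]
  have hn' : (a : ℚ) = (n : ℚ) * (p : ℚ) ^ k := by
    rw [zsmul_eq_mul, mul_one] at hn
    field_simp at hn
    linarith [hn]
  have : (a : ℤ) = n * (p : ℤ) ^ k := by exact_mod_cast hn'
  rw [this, Nat.cast_pow]
  exact Dvd.intro_left _ rfl

/-- **(⊇₁) `ker toX ⊆ range (Col♭ ∘ L)` from T-LIM in ORTH form.**  If every `w` with ORTH is congruent to some `L x` modulo `Ker Col♭`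
(`hlim`, the shape of hand hF1♭-LIM/LEV: `SSFlatPT.exists_snd_coleman_apply_eq_of_levelwise` once `ORTH → LEV`), `Col♭ = (J ·).2` is onto
(`hsurj`) and `toX` has the values (V̄), then `toX f = 0 ⇒ ∃ x, (J (L x)).2 = f`. [cite: Kobayashi2003, (7.17)–(7.21) (p. 12)]
[cite: GreenbergLNM1716, §4 p. 122] -/
theorem exists_snd_apply_eq_of_toX_eq_zero {Λ' H' : Type*}
    (J : (localTowerPointsOfEmb κ (closureEmb (K := K) (v.adicCompletion K)) W →+ ℤ_[p]) → Λ' × Λ')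
    (L : H' → (localTowerPointsOfEmb κ (closureEmb (K := K) (v.adicCompletion K)) W →+ ℤ_[p]))
    {δk : absoluteGaloisGroup K}
    (D : SharpFlatSelmerDualData W κ δk (closureEmb (K := K) (v.adicCompletion K)) ap g c .flat) (toX : Λ' → D.X)
    (hV : ∀ (w : localTowerPointsOfEmb κ (closureEmb (K := K) (v.adicCompletion K)) W →+ ℤ_[p])
        (s : sharpFlatSelmerInfty W κ (closureEmb (K := K) (v.adicCompletion K)) ap g c .flat)
        (φ : contOneCocycles (discreteTopRep κ.kerSubgroup (W.geomPrimaryTorsion p)))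
        (Q : localPoints W (v.adicCompletion K)) (k : ℕ)
        (hQ : (p ^ k) • Q ∈ localTowerPointsOfEmb κ (closureEmb (K := K) (v.adicCompletion K)) W),
        oneCocycleClass (discreteTopRep κ.kerSubgroup (W.geomPrimaryTorsion p)) φ = (s : W.subgroupH1 p κ.kerSubgroup) →
        (∀ τ : localSubgroupOfEmb κ.kerSubgroup (closureEmb (K := K) (v.adicCompletion K)),
          pointsMapOfEmb W (closureEmb (K := K) (v.adicCompletion K))
              ((φ.1 (resGalSubgroupOfEmb κ.kerSubgroup _ τ) : W.geomPrimaryTorsion p) : W.geomPoints) =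
            (τ : absoluteGaloisGroup (v.adicCompletion K)) • Q - Q) →
        ∀ a : ℤ, PadicInt.toZModPow k (w ⟨(p ^ k) • Q, hQ⟩) = (a : ZMod (p ^ k)) →
          D.toDual (toX (J w).2) s = (((a : ℚ) / (p : ℚ) ^ k : ℚ) : AddCircle (1 : ℚ)))
    (hsurj : ∀ f : Λ', ∃ w, (J w).2 = f)
    (hlim : ∀ w : localTowerPointsOfEmb κ (closureEmb (K := K) (v.adicCompletion K)) W →+ ℤ_[p],
      (∀ (s : sharpFlatSelmerInfty W κ (closureEmb (K := K) (v.adicCompletion K)) ap g c .flat)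
        (φ : contOneCocycles (discreteTopRep κ.kerSubgroup (W.geomPrimaryTorsion p)))
        (Q : localPoints W (v.adicCompletion K)) (k : ℕ)
        (hQ : (p ^ k) • Q ∈ localTowerPointsOfEmb κ (closureEmb (K := K) (v.adicCompletion K)) W),
        oneCocycleClass (discreteTopRep κ.kerSubgroup (W.geomPrimaryTorsion p)) φ = (s : W.subgroupH1 p κ.kerSubgroup) →
        (∀ τ : localSubgroupOfEmb κ.kerSubgroup (closureEmb (K := K) (v.adicCompletion K)),
          pointsMapOfEmb W (closureEmb (K := K) (v.adicCompletion K))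
              ((φ.1 (resGalSubgroupOfEmb κ.kerSubgroup _ τ) : W.geomPrimaryTorsion p) : W.geomPoints) =
            (τ : absoluteGaloisGroup (v.adicCompletion K)) • Q - Q) →
        PadicInt.toZModPow k (w ⟨(p ^ k) • Q, hQ⟩) = 0) →
      ∃ x : H', (J (L x)).2 = (J w).2)
    (f : Λ') (hf : toX f = 0) : ∃ x : H', (J (L x)).2 = f := by
  obtain ⟨w, rfl⟩ := hsurj f
  exact hlim w (orth_of_toX_apply_eq_zero W κ v (fun w ↦ (J w).2) D toX hV w hf)

end Dictionary

end SSFlatPT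

end Summit.BirchSwinnertonDyer.BirchSwinnertonDyer.Theorems

end
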